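/-
Copyright (c) 2026 the pub-hodgecm-mathlib formalisation cell (harness21).  Prover seat hodgecm-mathlib-LH4-p11 (g2), req620 Track A «(D-RAM) FOUR-FRAME» squad
(unit U3_Laws, (R-17) «NI2 ⊕ MS», MS ROAD A Stage B; brick B9-0₂ «ONE COSET AT TYPE 2» — THE ASSEMBLY over the type-2 shape list (B3₂) and the twins' stratum-wise
UNIQUENESS sockets (B4₂ ∕ B5₂ ∕ B7₂), into the `huniq₂` binder of ★ `F0P3cDyRamStableModelSumOfStageB.stableModelSum_of_stageB`).  2026-09-04.
-/
import Summits.HodgeConjecture.HodgeConjecture.Theorems.F0P3cDyRamDiagonalStrataDefs   -- ★ p855793 + ED. 2 p856137 (LH4-p10 ∕ this seat): `HasAxis`, `IsTypeTwoPolarisable`, `stratumTwo`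
import HarnessLib

/-!
# Crux `H413`, line LH4 «(D-RAM) FOUR-FRAME» road — unit U3_Laws (iii), MS ROAD A, brick B9-0₂: UNIQUENESS OF THE TYPE-2 POLARISATION ON `𝓛₀(T)` —
# assembled from the type-2 SHAPE LIST and STRATUM-WISE uniqueness (the sockets the type-2 twins deliver)

Cell `hodgecm-mathlib` (D-0151), FLOOR 0, crux item H413 = `stmt-HodgeConjecture-24833`, route of record `HCCMUnconditional`; squad F0∕P3c∕LH4 (req618∕req620); registered stub served:
`F0P3cDyRamFourFrameU3.stub_U3_stableModelSum` (MS; tree `Cruxes/H413/Lines/F0_P3c_DyRamFourFrame_U3_Laws.lean` :109).  THEOREMS ONLY (no `def`, no instance, no notation,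
no `sorry`, default heartbeats); lane `--supports stmt-HodgeConjecture-24833 --as helper` (count-neutral).  PURE BOOKKEEPING, no number theory: the inputs are hypotheses in
the exact currency of LH4-p10 (g2)'s type-2 skeleton `B10-StableCountTypeTwo.SKELETON.v1` 08e5e6e2d02c47d3 (`stub_B3_axis`, `stub_B3_shapes`) and of ★ StrataDefs ED. 2
(`stratumTwo σ ϖ T a`), so that each twin owes ONE uniqueness lemma per shape family and nothing else.

THE MATHEMATICS (LH4-p10 MEMO v2.1 §T2, B9-0 SCOPE NOTE 2026-09-03T23:57:56Z; ★ B9-0 p856086).  `huniq₂` — «at every `M₀ ∈ 𝓛₀(T)`, two non-degenerate `σ`-fixed diagonal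
forms of which `M₀` is a type-2 vertex differ by an element of `S_F(M₀)`» — is vacuous off the type-2-polarisable lattices; a polarisable `M₀ ∈ 𝓛₀(T)` has an axis vector `a`
(`haxis`, ★ B3 `exists_hasAxis`), which lies on the TYPE-2 SHAPE LIST (`hshapes`, B3₂-γ `stub_B3_shapes`: on-branch `(0,s,s)∕(s,0,s)∕(s,s,0)` with `s` odd; glued
`(r, r+s, r+s)` and permutations with `r` odd, `s ≥ 2` even; core-hanging `(r,r,r)` with `r` odd), so `M₀ ∈ stratumTwo σ ϖ T a` for a listed `a`, where the corresponding twin's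
uniqueness socket applies (`hT` on-branch — B4₂; `hG` glued — B5₂ (with §P for the feet on `B₂`, `B₃`); `hH` core-hanging — B7₂).  Output: the `huniq₂` binder of ★
`stableModelSum_of_stageB` at `T`, VERBATIM; ★ `hcoset_of_forall_unique` then yields the (O2c) `hcoset` binder.

WHAT IS PROVED (generic valued field, `N = 3`; no datum, no finiteness).
* `forall_unique_typeTwo_of_strata (T) (haxis) (hshapes) (hT) (hG) (hH) : ∀ M₀ ∈ normalisedStableLattices T, ‹uniqueness of the type-2 polarisation up to S_F(M₀)›`.
HONEST LABEL.  Count-neutral (`--supports`); CONDITIONAL on PROVER TARGETS taken as explicit hypotheses (B3₂ shapes, the three uniqueness sockets), none a literature fact;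
(MS) stays a PROVER TARGET; `HC_CM` is proved only modulo the 7 printed citations (2 remaining named inputs: hLiu418 = `stmt-HodgeConjecture-24832`, h413 =
`stmt-HodgeConjecture-24833`) until rung 0 closes.

## References
* [Kottwitz1986BaseChangeUnits] R. E. Kottwitz, *Base change for unit elements of Hecke algebras*, Compositio Math. 60 (1986), §1 pp. 240–241 (lattice counts modulo the torus,
  by position in the building).
* [Jacobowitz1962] R. Jacobowitz, *Hermitian forms over local fields*, Amer. J. Math. 84 (1962), §7 (modular lattices and their Gram matrices).
-/

set_option autoImplicit false

noncomputable section

namespace Summit.HodgeConjecture.HodgeConjecture.Cruxes.H413.F0P3cDyRamDiagonalPolarisationCosetTwo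

open Matrix
open Literature.NumberTheory.Automorphic Literature.NumberTheory.Automorphic.HermitianLattice
open Literature.NumberTheory.Automorphic.UnitaryLatticeTree
open Summit.HodgeConjecture.HodgeConjecture.Cruxes.H413.F0P3cDyRamDiagonalTorusDefs
open Summit.HodgeConjecture.HodgeConjecture.Cruxes.H413.F0P3cDyRamDiagonalStrataDefs
open scoped Valued WithZero Matrix MatrixGroups

variable {K : Type*} [Field K] [Valued K ℤᵐ⁰]

/-- **B9-0₂ ASSEMBLED: UNIQUENESS OF THE TYPE-2 POLARISATION AT EVERY `M₀ ∈ 𝓛₀(T)`** from (i) `haxis` — every member of `𝓛₀(T)` has an axis vector (★ B3 `exists_hasAxis`),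
(ii) `hshapes` — the TYPE-2 SHAPE LIST (B3₂-γ, skeleton 08e5e6e2 `stub_B3_shapes` VERBATIM: a type-2-polarisable `M ∈ 𝓛₀(T)` with axis `a` is on-branch with `s` odd, glued with
`r` odd and `s ≥ 2` even, or core-hanging with `r` odd), and (iii) three STRATUM-WISE UNIQUENESS SOCKETS over ★ `stratumTwo σ ϖ T a` — `hT` (on-branch, the three feet; B4₂),
`hG` (glued, the three feet; B5₂ + §P), `hH` (core-hanging; B7₂).  Conclusion = the `huniq₂` binder of ★ `F0P3cDyRamStableModelSumOfStageB.stableModelSum_of_stageB` at `T`.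
Pure case analysis. [cite: Kottwitz1986BaseChangeUnits, §1 pp. 240–241] [cite: Jacobowitz1962, §7] -/
theorem forall_unique_typeTwo_of_strata {σ : K →+* K} {ϖ : K} (T : GL (Fin 3) K)
    (haxis : ∀ M ∈ normalisedStableLattices T, ∃ a : Fin 3 → ℕ, HasAxis ϖ M a)
    (hshapes : ∀ {M : Submodule 𝒪[K] (Fin 3 → K)} {a : Fin 3 → ℕ}, M ∈ normalisedStableLattices T → IsTypeTwoPolarisable σ ϖ M → HasAxis ϖ M a →
      (∃ s, ¬ 2 ∣ s ∧ (a = ![0, s, s] ∨ a = ![s, 0, s] ∨ a = ![s, s, 0])) ∨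
      (∃ ρ s, 2 ∣ s ∧ 2 ≤ s ∧ (a = ![2 * ρ + 1, 2 * ρ + 1 + s, 2 * ρ + 1 + s] ∨ a = ![2 * ρ + 1 + s, 2 * ρ + 1, 2 * ρ + 1 + s] ∨
        a = ![2 * ρ + 1 + s, 2 * ρ + 1 + s, 2 * ρ + 1])) ∨
      (∃ ρ, a = ![2 * ρ + 1, 2 * ρ + 1, 2 * ρ + 1]))
    (hT : ∀ s : ℕ, ¬ 2 ∣ s → ∀ a : Fin 3 → ℕ, (a = ![0, s, s] ∨ a = ![s, 0, s] ∨ a = ![s, s, 0]) →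
      ∀ M ∈ stratumTwo σ ϖ T a, ∀ D₁ : Fin 3 → K, (∀ i, σ (D₁ i) = D₁ i ∧ D₁ i ≠ 0) → IsVertexLattice σ ϖ (Matrix.diagonal D₁) 2 M →
        ∀ D : Fin 3 → K, (∀ i, σ (D i) = D i ∧ D i ≠ 0) → IsVertexLattice σ ϖ (Matrix.diagonal D) 2 M →
          ∃ u ∈ fixedUnitStabilizer σ M, ∀ i, D i = D₁ i * (u i : Kˣ))
    (hG : ∀ ρ s : ℕ, 2 ∣ s → 2 ≤ s → ∀ a : Fin 3 → ℕ, (a = ![2 * ρ + 1, 2 * ρ + 1 + s, 2 * ρ + 1 + s] ∨ a = ![2 * ρ + 1 + s, 2 * ρ + 1, 2 * ρ + 1 + s] ∨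
        a = ![2 * ρ + 1 + s, 2 * ρ + 1 + s, 2 * ρ + 1]) →
      ∀ M ∈ stratumTwo σ ϖ T a, ∀ D₁ : Fin 3 → K, (∀ i, σ (D₁ i) = D₁ i ∧ D₁ i ≠ 0) → IsVertexLattice σ ϖ (Matrix.diagonal D₁) 2 M →
        ∀ D : Fin 3 → K, (∀ i, σ (D i) = D i ∧ D i ≠ 0) → IsVertexLattice σ ϖ (Matrix.diagonal D) 2 M →
          ∃ u ∈ fixedUnitStabilizer σ M, ∀ i, D i = D₁ i * (u i : Kˣ))
    (hH : ∀ ρ : ℕ, ∀ M ∈ stratumTwo σ ϖ T ![2 * ρ + 1, 2 * ρ + 1, 2 * ρ + 1],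
      ∀ D₁ : Fin 3 → K, (∀ i, σ (D₁ i) = D₁ i ∧ D₁ i ≠ 0) → IsVertexLattice σ ϖ (Matrix.diagonal D₁) 2 M →
        ∀ D : Fin 3 → K, (∀ i, σ (D i) = D i ∧ D i ≠ 0) → IsVertexLattice σ ϖ (Matrix.diagonal D) 2 M →
          ∃ u ∈ fixedUnitStabilizer σ M, ∀ i, D i = D₁ i * (u i : Kˣ)) :
    ∀ M₀ ∈ normalisedStableLattices T, ∀ D₁ : Fin 3 → K, (∀ i, σ (D₁ i) = D₁ i ∧ D₁ i ≠ 0) →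
      IsVertexLattice σ ϖ (Matrix.diagonal D₁) 2 M₀ → ∀ D : Fin 3 → K, (∀ i, σ (D i) = D i ∧ D i ≠ 0) →
        IsVertexLattice σ ϖ (Matrix.diagonal D) 2 M₀ → ∃ u ∈ fixedUnitStabilizer σ M₀, ∀ i, D i = D₁ i * (u i : Kˣ) := by
  intro M₀ hM₀ D₁ hD₁ hV₁ D hD hV
  -- `M₀` is type-2 polarisable (by `D₁`), has an axis vector, and the axis is on the shape list
  have hpol : IsTypeTwoPolarisable σ ϖ M₀ := ⟨D₁, hD₁, hV₁⟩
  obtain ⟨a, ha⟩ := haxis M₀ hM₀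
  have hmem : M₀ ∈ stratumTwo σ ϖ T a := ⟨hM₀, hpol, ha⟩
  rcases hshapes hM₀ hpol ha with ⟨s, hs, hsa⟩ | ⟨ρ, s, hs, hs2, hρa⟩ | ⟨ρ, rfl⟩
  · exact hT s hs a hsa M₀ hmem D₁ hD₁ hV₁ D hD hV
  · exact hG ρ s hs hs2 a hρa M₀ hmem D₁ hD₁ hV₁ D hD hV
  · exact hH ρ M₀ hmem D₁ hD₁ hV₁ D hD hV

end Summit.HodgeConjecture.HodgeConjecture.Cruxes.H413.F0P3cDyRamDiagonalPolarisationCosetTwo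

end
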